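import Mathlib
import HarnessLib
import Literature.NumberTheory.GaloisRepresentations.TateLocalH2Nonvanishing
import Summits.Langlands.Langlands.Theses.TriangulineChamber

/-!
# `OrdinaryComponent` (item stmt-Langlands-8607, support of route `TriangulineChamber`):
# the obstruction group `H²(G_K, k)` of part (1) does not vanish for every finite `K/ℚ_p`, `p > 2`

The informal support item `OrdinaryComponent` of route `TriangulineChamber` (no Lean declaration
yet) asserts for an ARBITRARY finite `K/ℚ_p` that the functor of `B_ℓ`-valued framed lifts of a
generic reducible `ρ̄ : G_K → GL₂(k)` is formally smooth over `𝒪_L` "because `H²(G_K, ad 𝔟̄_ℓ) = 0`: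
its graded pieces are `H²(k) = 0 (p > 2)` and `H²(χ̄_sub χ̄_quot⁻¹) = 0`", with connected generic
fibre, and (part (2)) that the `ℓ`-ordinary closure `Z_ℓ` is irreducible.  By local Tate duality
`H²(G_K, 𝔽_p) ≅ μ_p(K)^∨`, which vanishes iff `ζ_p ∉ K` — guaranteed by `p > 2` only for `K = ℚ_p`.

This file records, against the item, the hypothesis-free packaging of the landed Literature
witness `Literature.NumberTheory.GaloisRepresentations.exists_twoCocycle_not_pTorsionCoboundary_cyclotomic_padic`:
for EVERY prime `p` there is a finite extension `K/ℚ_p` (namely `ℚ_p(ζ_p)`) with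
`H²(Γ_K, ℤ/p) ≠ 0` in cochain form.  Consequences for the item (evidence file
`evidence-8607-misstated.md` on the ledger): for `K ∋ ζ_p` the lift functor is not formally smooth
over `𝒪_L`, its generic fibre has `|μ_{p^∞}(K)|²` connected components, and `Z_ℓ` is a disjoint
union of that many irreducible components (one over each torsion type with the tame part of `ℓ`);
parts (3)–(5) of the item hold for every `K`.
-/

set_option linter.dupNamespace false -- project-wide option (lakefile weak.linter.dupNamespace); `Summit.Langlands.Langlands` is the mandated namespace

noncomputable section

namespace Summit.Langlands.Langlands.Theorems.OrdinaryComponent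

open Function Field Literature.NumberTheory.GaloisRepresentations

/-- **For every prime `p` some finite `K/ℚ_p` has `H²(Γ_K, ℤ/p) ≠ 0`** (cochain form: a locally
constant `p`-torsion `2`-cocycle `Γ_K × Γ_K → ℚ/ℤ`, trivial action, that is not the coboundary of a
locally constant `p`-torsion cochain), namely `K = ℚ_p(ζ_p) = CyclotomicField p ℚ_[p]`, of degree
`≤ p - 1` over `ℚ_p`.  Hence the parenthetical "`H²(G_K, k) = 0 (p > 2)`" of item `OrdinaryComponent`,
stated for an arbitrary finite `K/ℚ_p`, fails for some `K` for every `p`, and the item needs the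
hypothesis `μ_p(K) = 1` (or its per-det-component restatement).  A repackaging of
`exists_twoCocycle_not_pTorsionCoboundary_cyclotomic_padic` (Serre, Durham 1977, §6.5 (b)).
[cite: SerreDurham1977, §6.5 (b)] -/
theorem exists_finite_extension_padic_H2_modp_ne_zero (p : ℕ) [hp : Fact p.Prime] :
    ∃ (K : Type) (_ : Field K) (_ : Algebra ℚ_[p] K), FiniteDimensional ℚ_[p] K ∧
      ∃ d : absoluteGaloisGroup K → absoluteGaloisGroup K → AddCircle (1 : ℚ),
        IsLocallyConstant (Function.uncurry d) ∧
        (∀ σ τ υ, d σ τ + d (σ * τ) υ = d τ υ + d σ (τ * υ)) ∧ (∀ σ τ, p • d σ τ = 0) ∧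
        ∀ β : absoluteGaloisGroup K → AddCircle (1 : ℚ), IsLocallyConstant β →
          (∀ σ, p • β σ = 0) → ¬ ∀ σ τ, d σ τ = β σ + β τ - β (σ * τ) := by
  haveI : NeZero p := ⟨hp.out.ne_zero⟩
  exact ⟨CyclotomicField p ℚ_[p], inferInstance, inferInstance,
    IsCyclotomicExtension.finiteDimensional {p} ℚ_[p] (CyclotomicField p ℚ_[p]),
    exists_twoCocycle_not_pTorsionCoboundary_cyclotomic_padic p⟩

end Summit.Langlands.Langlands.Theorems.OrdinaryComponent

end
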